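import Mathlib.Algebra.BigOperators.Ring.Finset
import Summits.PneNP.PneNP.Theorems.ReslinMediumCoverManyMediumLinesEdgeFlip

/-!
# PneNP / ReslinMediumCover — fibres of the lifted-edge-value map of `τ(G, c) ∘ MAJ₃`
(helper for stub CD "critical density" of crux `ManyMediumLines`, stmt-PneNP-19698)

Route `PneNP/ReslinMediumCover`, crux `Summit.PneNP.PneNP.Theses.ReslinMediumCover.ManyMediumLines`
(open problem; NOT claimed). The map `x ↦ (edgeVal (pad x) e)_{e ∈ E(G)}` from assignments of the
`3N²` slots to lifted edge values has ALL FIBRES OF THE SAME SIZE `2^{3N² - |E(G)|}`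
(`card_filter_edgeVal_eq`): negating the three slots of one edge flips exactly that lifted value
(`MAJ₃(¬a, ¬b, ¬c) = ¬MAJ₃(a, b, c)`), so block negations act transitively on the targets, and the
`2^{|E(G)|}` fibres partition the `2^{3N²}` assignments. Used by the critical-density count
`|critAt G c u| = 2^{3N² - N + 1}`.

References: S. K. Bhattacharya, F. Byramji, A. Chattopadhyay, R. Impagliazzo, STOC 2026, Thm 1.2
(the gadget `MAJ₃` is balanced / self-dual); folklore counting.
-/

namespace Summit.PneNP.PneNP.Theorems

-- `Summit.PneNP.PneNP` repeats a path component by design (summit = sub-problem); silence the linter.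
set_option linter.dupNamespace false

namespace ResLinBoundaryLaw

open Finset Literature.Computability.Complexity Literature.Computability.MetaComplexity

variable {N : ℕ} (G : SimpleGraph (Fin N)) [DecidableRel G.Adj]

/-- `MAJ₃` is self-dual: negating all inputs negates the output. -/
theorem gadgetMaj3_not (a b c : Bool) : gadgetMaj3 (!a) (!b) (!c) = !gadgetMaj3 a b c := by
  cases a <;> cases b <;> cases c <;> rfl

/-- **Block negation**: negating the three slots of `e₀` flips the lifted value of `e₀` and keeps every
other lifted edge value. -/
theorem edgeVal_negBlock (e₀ : Sym2 (Fin N)) (x : Fin (3 * N ^ 2) → Bool) (e : Sym2 (Fin N)) :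
    edgeVal (pad fun s => if ∃ i : Fin 3, (s : ℕ) = liftVar e₀ i.1 then !x s else x s) e =
      if e = e₀ then !edgeVal (pad x) e else edgeVal (pad x) e := by
  classical
  set x' : Fin (3 * N ^ 2) → Bool :=
    fun s => if ∃ i : Fin 3, (s : ℕ) = liftVar e₀ i.1 then !x s else x s with hx'
  have hslot : ∀ (i : ℕ) (hi : i < 3),
      pad x' (liftVar e i) = if e = e₀ then !pad x (liftVar e i) else pad x (liftVar e i) := by
    intro i hi
    rw [pad_liftVar x' e hi, pad_liftVar x e hi]
    show (if ∃ i' : Fin 3, ((⟨liftVar e i, liftVar_lt e hi⟩ : Fin (3 * N ^ 2)) : ℕ) = liftVar e₀ i'.1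
      then !x ⟨liftVar e i, liftVar_lt e hi⟩ else x ⟨liftVar e i, liftVar_lt e hi⟩) = _
    by_cases he : e = e₀
    · subst he
      rw [if_pos ⟨⟨i, hi⟩, rfl⟩, if_pos rfl]
    · rw [if_neg, if_neg he]
      rintro ⟨i', hi'⟩
      exact he (liftVar_inj hi i'.2 hi').1
  unfold edgeVal
  rw [hslot 0 (by norm_num), hslot 1 (by norm_num), hslot 2 (by norm_num)]
  by_cases he : e = e₀
  · simp only [if_pos he, gadgetMaj3_not]
  · simp only [if_neg he]

/-- **All fibres of the lifted-edge-value map have the same size**, namely `2^{3N² - |E(G)|}`: the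
number of assignments of the `3N²` slots whose lifted edge values on the edges of `G` are a
prescribed `y`. -/
theorem card_filter_edgeVal_eq (y : ↥G.edgeFinset → Bool) :
    (Finset.univ.filter fun x : Fin (3 * N ^ 2) → Bool =>
        (fun e : ↥G.edgeFinset => edgeVal (pad x) e.1) = y).card =
      2 ^ (3 * N ^ 2 - G.edgeFinset.card) := by
  classical
  -- notation
  let E : Type := ↥G.edgeFinset
  let pat : (Fin (3 * N ^ 2) → Bool) → E → Bool := fun x e => edgeVal (pad x) e.1
  let fib : (E → Bool) → Finset (Fin (3 * N ^ 2) → Bool) :=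
    fun y => Finset.univ.filter fun x => pat x = y
  let neg : Sym2 (Fin N) → (Fin (3 * N ^ 2) → Bool) → Fin (3 * N ^ 2) → Bool :=
    fun e₀ x s => if ∃ i : Fin 3, (s : ℕ) = liftVar e₀ i.1 then !x s else x s
  -- one block negation moves a fibre onto the fibre of the flipped target
  have hpat_neg : ∀ (e₀ : E) (x : Fin (3 * N ^ 2) → Bool),
      pat (neg e₀.1 x) = Function.update (pat x) e₀ (!pat x e₀) := by
    intro e₀ x
    funext e
    show edgeVal (pad (neg e₀.1 x)) e.1 = _
    rw [show edgeVal (pad (neg e₀.1 x)) e.1 = if e.1 = e₀.1 then !edgeVal (pad x) e.1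
      else edgeVal (pad x) e.1 from edgeVal_negBlock e₀.1 x e.1]
    by_cases he : e = e₀
    · subst he
      simp [pat]
    · have he' : e.1 ≠ e₀.1 := fun h => he (Subtype.ext h)
      rw [if_neg he', Function.update_of_ne he]
  have hneg_neg : ∀ (e₀ : Sym2 (Fin N)) (x : Fin (3 * N ^ 2) → Bool), neg e₀ (neg e₀ x) = x := by
    intro e₀ x
    funext s
    by_cases h : ∃ i : Fin 3, (s : ℕ) = liftVar e₀ i.1
    · simp only [neg, if_pos h, Bool.not_not]
    · simp only [neg, if_neg h]
  have hflip : ∀ (e₀ : E) (y : E → Bool),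
      (fib y).card = (fib (Function.update y e₀ (!y e₀))).card := by
    intro e₀ y
    have hinj : Function.Injective (neg e₀.1) := by
      intro x x' h
      rw [← hneg_neg e₀.1 x, h, hneg_neg]
    rw [← Finset.card_image_of_injective (fib y) hinj]
    congr 1
    ext x'
    simp only [fib, Finset.mem_image, Finset.mem_filter, Finset.mem_univ, true_and]
    constructor
    · rintro ⟨x, hx, rfl⟩
      rw [hpat_neg, hx]
    · intro hx'
      refine ⟨neg e₀.1 x', ?_, hneg_neg _ _⟩
      rw [hpat_neg, hx']
      funext e
      by_cases he : e = e₀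
      · subst he
        simp
      · rw [Function.update_of_ne he, Function.update_of_ne he]
  -- hence all fibres have the same size (induction on the set where two targets differ)
  have hall : ∀ (s : Finset E) (y y' : E → Bool), (∀ e, y e ≠ y' e → e ∈ s) →
      (fib y).card = (fib y').card := by
    intro s
    induction s using Finset.induction_on with
    | empty =>
      intro y y' h
      have : y = y' := funext fun e => by
        by_contra hne
        exact absurd (h e hne) (Finset.notMem_empty e)
      rw [this]
    | insert e₀ s he₀ ih =>
      intro y y' h
      by_cases hy : y e₀ = y' e₀
      · exact ih y y' fun e hne => by
          have := h e hne
          rw [Finset.mem_insert] at this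
          rcases this with rfl | hmem
          · exact absurd hy hne
          · exact hmem
      · rw [hflip e₀ y]
        refine ih _ y' fun e hne => ?_
        by_cases hee : e = e₀
        · subst hee
          rw [Function.update_self] at hne
          revert hy hne
          cases y e <;> cases y' e <;> simp
        · rw [Function.update_of_ne hee] at hne
          have := h e hne
          rw [Finset.mem_insert] at this
          rcases this with rfl | hmem
          · exact absurd rfl hee
          · exact hmem
  have hconst : ∀ y', (fib y').card = (fib y).card :=
    fun y' => hall Finset.univ y' y fun e _ => Finset.mem_univ e
  -- the fibres partition all assignments
  have hsum : (Finset.univ : Finset (Fin (3 * N ^ 2) → Bool)).card =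
      ∑ y' : E → Bool, (fib y').card :=
    Finset.card_eq_sum_card_fiberwise (f := pat) (fun x _ => Finset.mem_univ (pat x))
  simp only [hconst, Finset.sum_const, smul_eq_mul, Finset.card_univ] at hsum
  rw [Fintype.card_fun, Fintype.card_bool, Fintype.card_fin, Fintype.card_fun, Fintype.card_bool,
    Fintype.card_coe] at hsum
  -- `2^{3N²} = 2^{|E|} · |fibre|`
  have hE : G.edgeFinset.card ≤ 3 * N ^ 2 := by
    by_contra hlt
    push Not at hlt
    have h1 : 2 ^ (3 * N ^ 2) < 2 ^ G.edgeFinset.card := Nat.pow_lt_pow_right (by norm_num) hlt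
    have h2 : 1 ≤ (fib y).card := by
      rcases Nat.eq_zero_or_pos (fib y).card with h | h
      · rw [h, mul_zero] at hsum
        exact absurd hsum (by positivity)
      · exact h
    have h3 : 2 ^ G.edgeFinset.card * 1 ≤ 2 ^ G.edgeFinset.card * (fib y).card :=
      Nat.mul_le_mul_left _ h2
    rw [mul_one, ← hsum] at h3
    exact absurd h1 (not_lt.mpr h3)
  show (fib y).card = _
  have hpow : 2 ^ (3 * N ^ 2) = 2 ^ G.edgeFinset.card * 2 ^ (3 * N ^ 2 - G.edgeFinset.card) := by
    rw [← pow_add, Nat.add_sub_cancel' hE]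
  rw [hpow] at hsum
  exact (Nat.eq_of_mul_eq_mul_left (by positivity) hsum).symm

end ResLinBoundaryLaw

end Summit.PneNP.PneNP.Theorems
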